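import Summits.CriticalPhenomena.PercolationContinuityZ3.Theorems.PercNearOneGluingNoHeavyLowerTailKernelRows
import HarnessLib

/-!
# Kernel rows, Gladkov–Zimin cone form

Helper file for crux `stmt-CriticalPhenomena-4575` (`NoHeavyLowerTail`), new-inequality factory seat
`prim-ineq-gen-1` (gen 2); companion of `PercNearOneGluingNoHeavyLowerTailKernelRows.lean`.  Everything here
is PROVED.

**Theorem (`prodBernoulli_gzRow`).**  `μ = prodBernoulli p` on `Set ι` (`ι` finite), `Q` a finite preorder,
`λ : Set ι → Q` monotone, `m x = μ(λ = x)`, and `κ : Q → Q → ℝ` ANY kernel submodular on comparable rectangles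
(`κ a₁ b₁ + κ a₀ b₀ ≤ κ a₁ b₀ + κ a₀ b₁` for `a₀ ≤ a₁`, `b₀ ≤ b₁`; no sign hypothesis).  Then
`Σ_x κ(x,x) m(x) ≤ Σ_{x,y} κ(x,y) m(x) m(y)`, i.e. with `A = −κ` ("cover-supermodular"):
`(Σ m)·Σ_a A_aa m_a − mᵀ A m = ⟨A, (Σm) diag(m) − m mᵀ⟩ ≥ 0`.
For `Q` = set partitions of marked vertices ordered by coarsening and `λ` = partition into open clusters
this is exactly the "GZ cone" of quadratic rows of the wf3lp / gz certificate lanes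
(run/shared/lean/ttrl/gz/README.md §0, re-derived there on paper from Gladkov–Zimin, arXiv:2404.08873, §4);
here it is proved in Lean for arbitrary monotone statistics of product measures.  Proof: the induction of the
companion file; the diagonal term is affine along each section segment and the base case is an equality.
-/

noncomputable section

namespace Summit.CriticalPhenomena.PercolationContinuityZ3.Theorems


namespace KernelRows

open MeasureTheory Finset Literature.Probability.LatticeModels Literature.Probability.Percolation
open Literature.Probability.LatticeModels.StrongHarris

variable {ι : Type*} {Q : Type*} [Fintype Q] (κ : Q → Q → ℝ)

/-- **Gladkov–Zimin cone rows for cylinder statistics.**  For `μ = prodBernoulli p`, a monotone statistic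
`λ : Set ι → Q` (finite preorder `Q`) with fibres determined by the finite set `F`, and ANY kernel `κ`
submodular on comparable rectangles: `Σ_x κ(x,x) μ(λ=x) ≤ Σ_{x,y} κ(x,y) μ(λ=x) μ(λ=y)`.
[new Lean; statement = the dual form of the GZ cone, cf. Gladkov–Zimin arXiv:2404.08873 §4] -/
theorem prodBernoulli_gzRow_of_determinedBy [DecidableEq Q] [Preorder Q] (p : ι → unitInterval)
    (hsub : ∀ a₀ a₁ b₀ b₁ : Q, a₀ ≤ a₁ → b₀ ≤ b₁ → κ a₁ b₁ + κ a₀ b₀ ≤ κ a₁ b₀ + κ a₀ b₁)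
    (F : Finset ι) :
    ∀ lam : Set ι → Q, (∀ ⦃ω ω' : Set ι⦄, ω ⊆ ω' → lam ω ≤ lam ω') →
      (∀ q, DeterminedBy (lam ⁻¹' {q}) (↑F : Set ι)) →
      ∑ x, κ x x * (prodBernoulli p).real (lam ⁻¹' {x}) ≤
        qform κ (fun x => (prodBernoulli p).real (lam ⁻¹' {x}))
          (fun x => (prodBernoulli p).real (lam ⁻¹' {x})) := by
  classical
  induction F using Finset.induction_on with
  | empty =>
    intro lam _ hdet
    have hconst : ∀ ω, lam ω = lam ∅ := by
      intro ω
      have h := (determinedBy_iff _ _).1 (hdet (lam ∅)) ∅ ω (by simp)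
      simpa using h
    have hm : (fun x => (prodBernoulli p).real (lam ⁻¹' {x})) = Pi.single (lam ∅) (1 : ℝ) := by
      ext x
      by_cases hx : x = lam ∅
      · subst hx
        have : lam ⁻¹' {lam ∅} = Set.univ := by
          ext ω; simp [hconst ω]
        rw [this]; simp
      · have : lam ⁻¹' {x} = ∅ := by
          ext ω; simp only [Set.mem_preimage, Set.mem_singleton_iff, Set.mem_empty_iff_false,
            iff_false]; rw [hconst ω]; exact Ne.symm hx
        rw [this]; simp [hx]
    have hlin : ∑ x, κ x x * (prodBernoulli p).real (lam ⁻¹' {x}) = κ (lam ∅) (lam ∅) := by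
      have : ∀ x, κ x x * (prodBernoulli p).real (lam ⁻¹' {x}) =
          κ x x * (Pi.single (lam ∅) (1 : ℝ) : Q → ℝ) x := fun x => by rw [← hm]
      simp_rw [this]
      simp [Pi.single_apply]
    rw [hlin, hm, qform_single]
  | insert e F' he ih =>
    intro lam hmono hdet
    set μ := prodBernoulli p with hμ
    set lam1 : Set ι → Q := fun ω => lam (insert e ω) with hlam1
    set lam0 : Set ι → Q := fun ω => lam (ω \ {e}) with hlam0
    have hmono1 : ∀ ⦃ω ω' : Set ι⦄, ω ⊆ ω' → lam1 ω ≤ lam1 ω' :=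
      fun ω ω' h => hmono (Set.insert_subset_insert h)
    have hmono0 : ∀ ⦃ω ω' : Set ι⦄, ω ⊆ ω' → lam0 ω ≤ lam0 ω' :=
      fun ω ω' h => hmono fun x hx => ⟨h hx.1, hx.2⟩
    have hdet1 : ∀ q, DeterminedBy (lam1 ⁻¹' {q}) (↑F' : Set ι) :=
      fun q => determinedBy_preimage_insert (hdet q)
    have hdet0 : ∀ q, DeterminedBy (lam0 ⁻¹' {q}) (↑F' : Set ι) :=
      fun q => determinedBy_preimage_sdiff (hdet q)
    set m1 : Q → ℝ := fun x => μ.real (lam1 ⁻¹' {x}) with hm1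
    set m0 : Q → ℝ := fun x => μ.real (lam0 ⁻¹' {x}) with hm0
    have ih1 : ∑ x, κ x x * m1 x ≤ qform κ m1 m1 := ih lam1 hmono1 hdet1
    have ih0 : ∑ x, κ x x * m0 x ≤ qform κ m0 m0 := ih lam0 hmono0 hdet0
    set t : ℝ := (p e : ℝ) with ht
    have ht0 : 0 ≤ t := (p e).2.1
    have ht1 : t ≤ 1 := (p e).2.2
    have hdecx : ∀ x, μ.real (lam ⁻¹' {x}) = m0 x + t * (m1 x - m0 x) := by
      intro x
      have := real_eq_preimage_insert_add_preimage_sdiff p e (hdet x)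
      simp only [hm0, hm1, hlam0, hlam1]
      rw [hμ] at *
      rw [this]
      simp only [Set.preimage_preimage]
      ring
    have hdec : (fun x => μ.real (lam ⁻¹' {x})) = m0 + t • (m1 - m0) := by
      ext x; rw [hdecx x]; simp
    -- transition masses (as in `prodBernoulli_kernelRow_of_determinedBy`)
    set τ : Q → Q → ℝ := fun u v => μ.real (lam0 ⁻¹' {u} ∩ lam1 ⁻¹' {v}) with hτ
    have hmeas : ∀ u v, MeasurableSet (lam0 ⁻¹' {u} ∩ lam1 ⁻¹' {v}) := fun u v =>
      ((hdet0 u).measurableSet_of_finset).inter ((hdet1 v).measurableSet_of_finset)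
    have hτnn : ∀ u v, 0 ≤ τ u v := fun u v => measureReal_nonneg
    have hτle : ∀ u v, τ u v ≠ 0 → u ≤ v := by
      intro u v hne
      by_contra hle
      apply hne
      have : lam0 ⁻¹' {u} ∩ lam1 ⁻¹' {v} = ∅ := by
        ext ω
        simp only [Set.mem_inter_iff, Set.mem_preimage, Set.mem_singleton_iff,
          Set.mem_empty_iff_false, iff_false, not_and]
        intro hu hv
        apply hle
        rw [← hu, ← hv]
        exact hmono fun x hx => Set.mem_insert_of_mem _ hx.1
      simp [hτ, this]
    set pr : Set ι → Q × Q := fun ω => (lam0 ω, lam1 ω) with hpr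
    have hfib : ∀ z : Q × Q, pr ⁻¹' {z} = lam0 ⁻¹' {z.1} ∩ lam1 ⁻¹' {z.2} := by
      intro z; ext ω; simp [hpr, Prod.ext_iff]
    have hm0sum : ∀ u, m0 u = ∑ v, τ u v := by
      intro u
      have hs := sum_measureReal_preimage_singleton (μ := μ) ({u} ×ˢ (univ : Finset Q))
        (f := pr) (fun z _ => by rw [hfib]; exact hmeas _ _)
      rw [sum_product] at hs
      simp only [sum_singleton] at hs
      have e1 : pr ⁻¹' (↑({u} ×ˢ (univ : Finset Q)) : Set (Q × Q)) = lam0 ⁻¹' {u} := by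
        ext ω; simp [hpr, eq_comm]
      rw [e1] at hs
      rw [hm0]
      simp only
      rw [← hs]
      exact sum_congr rfl fun v _ => by rw [hfib]
    have hm1sum : ∀ v, m1 v = ∑ u, τ u v := by
      intro v
      have hs := sum_measureReal_preimage_singleton (μ := μ) ((univ : Finset Q) ×ˢ {v})
        (f := pr) (fun z _ => by rw [hfib]; exact hmeas _ _)
      rw [sum_product] at hs
      simp only [sum_singleton] at hs
      have e1 : pr ⁻¹' (↑((univ : Finset Q) ×ˢ {v}) : Set (Q × Q)) = lam1 ⁻¹' {v} := by
        ext ω; simp [hpr, eq_comm]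
      rw [e1] at hs
      rw [hm1]
      simp only
      rw [← hs]
      exact sum_congr rfl fun u _ => by rw [hfib]
    have hΔ : m1 - m0 = fun x => ∑ u, τ u x - ∑ v, τ x v := by
      ext x; simp only [Pi.sub_apply]; rw [hm1sum, hm0sum]
    have hneg : qform κ (m1 - m0) (m1 - m0) ≤ 0 := by
      rw [hΔ]; exact qform_transition_nonpos κ hsub τ hτnn hτle
    -- the linear term is affine along the segment
    have hlin : ∑ x, κ x x * μ.real (lam ⁻¹' {x}) =
        (1 - t) * ∑ x, κ x x * m0 x + t * ∑ x, κ x x * m1 x := by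
      rw [mul_sum, mul_sum, ← sum_add_distrib]
      refine sum_congr rfl fun x _ => ?_
      rw [hdecx x]; ring
    rw [hlin, hdec, qform_segment]
    have h3 : 0 ≤ (t ^ 2 - t) * qform κ (m1 - m0) (m1 - m0) :=
      mul_nonneg_of_nonpos_of_nonpos (by nlinarith) hneg
    nlinarith [mul_le_mul_of_nonneg_left ih0 (by linarith : (0:ℝ) ≤ 1 - t),
      mul_le_mul_of_nonneg_left ih1 ht0, h3]

/-- **Gladkov–Zimin cone rows, finite index type.**  For `μ = prodBernoulli p` (`ι` finite), a monotone
statistic `λ : Set ι → Q` into a finite preorder, and any kernel `κ` submodular on comparable rectangles: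
`Σ_x κ(x,x) μ(λ=x) ≤ Σ_{x,y} κ(x,y) μ(λ=x) μ(λ=y)`.  With `Q` = set partitions of marked vertices ordered by
coarsening and `λ` = "partition into open clusters", these are exactly the rows of the GZ cone of the
wf3lp/gz certificate lanes (`A = −κ` cover-supermodular: `(Σm) Σ_a A_aa m_a − mᵀ A m ≥ 0`). [new Lean] -/
theorem prodBernoulli_gzRow [Finite ι] [DecidableEq Q] [Preorder Q] (p : ι → unitInterval)
    (hsub : ∀ a₀ a₁ b₀ b₁ : Q, a₀ ≤ a₁ → b₀ ≤ b₁ → κ a₁ b₁ + κ a₀ b₀ ≤ κ a₁ b₀ + κ a₀ b₁)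
    (lam : Set ι → Q) (hmono : ∀ ⦃ω ω' : Set ι⦄, ω ⊆ ω' → lam ω ≤ lam ω') :
    ∑ x, κ x x * (prodBernoulli p).real (lam ⁻¹' {x}) ≤
      ∑ x, ∑ y, κ x y * ((prodBernoulli p).real (lam ⁻¹' {x}) * (prodBernoulli p).real (lam ⁻¹' {y})) := by
  classical
  haveI := Fintype.ofFinite ι
  have hall : ∀ X : Set (Set ι), DeterminedBy X (↑(Finset.univ : Finset ι) : Set ι) := fun X => by
    rw [determinedBy_iff]; intro ω ω' h; simp only [Finset.coe_univ, Set.inter_univ] at h; rw [h]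
  exact prodBernoulli_gzRow_of_determinedBy κ p hsub Finset.univ lam hmono fun q => hall _

end KernelRows

end Summit.CriticalPhenomena.PercolationContinuityZ3.Theorems
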